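import Summits.PneNP.PneNP.Theorems.ChebyshevTracialDesignSpectralNonTightnessLayers
import Summits.PneNP.PneNP.Theorems.ChebyshevTracialDesignSpectralNonTightnessEstimates
import HarnessLib

/-!
# Cell pnp-psdrank, route `ChebyshevTracialDesign`: SPECTRAL NON-TIGHTNESS (SNT) — a dense family of `t`-cuts and a homogeneous dense
# family of perfect matchings always contain a tight pair (step S4 of the `r = 1` rung, modulo Keevash–Lifshitz Thm 1.8)

Harmonic backbone of the crux `TracialDecayExp20` (stmt-PneNP-19878), brick 28 (prover g8; MEMO-9 §6 work order S4; planner p1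
N2-SpreadStructure §SNT (1)). THEOREM (`snt_of_globalLevelD`): assume the named fact `GlobalLevelDInequality` [cite: KeevashLifshitz2023, Thm. 1.8].
For every `τ ≥ 1` there are `c₀ > 0` and `n₁` such that for all even `n ≥ n₁`, all odd balanced `t = 2c'+1` (`2t ≤ n ≤ 4t`), every family
`X` of `t`-subsets of `[n]` with `μ(X) = |X|/C(n,t) ≥ exp(−c₀·dq n)` and every set `Y` of perfect matchings of `K_n` whose edge sets form a
`(PM_n, τ)`-homogeneous family (Kupavskii–Zakharov [cite: KupavskiiZakharov2022, §2]) with `ν(Y) = |Y|/|PM_n| ≥ exp(−c₀·dq n)`, SOME pair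
`(U, M) ∈ X × Y` is tight: `|δ(U) ∩ M| = 1` (`dq n = ⌊⌊√n⌋^{1/2}⌋ ≍ n^{1/4}` is the route's exactness degree). Route-currency corollary
`snt_oddSet_of_globalLevelD` (`X : Finset (OddSet n)`, `cc U M = 1`).
PROOF (as formalised; bricks 25–27). If `X × Y` were tight-free, the normalised layer identity (brick 27 `density_mul_density_le_sum_abs`)
gives `μν ≤ Σ_{κ=1}^{c'} |T_{2κ}|/(|PM_n|N_1)`. HEAD `κ ≤ dq n + 8`: by the slice level-`2κ` inequality (F1, PROVED, brick 27 `ladder_ip_le_level`)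
`√(A_κ L_{2κ}/C(n,t)) ≤ 4μ·Φ^κ`, `Φ = 96e(ln(1/μ) + 3κ)/(dq n)²` (`A_κ ≤ (4κ/n)^κ`, `n ≥ (dq n)⁴`); in the Keevash–Lifshitz range
`2κ ≤ ⅛ log(1/ν)` brick 27's KL form gives `|T_{2κ}|/(|PM_n|N_1) ≤ 4μν(GΦ)^κ` with `GΦ = Cτ² log(1/ν)·F/(dq n)² ≤ 171Cτ²c₀² ≤ 1/16`; outside it
`√ν ≤ ν e^{8κ}` and the Parseval form gives `≤ 4μν(e⁸Φ)^κ`, `e⁸Φ ≤ 1889568(4 dq n + 24)/(dq n)² ≤ 1/16` — so every head term is `≤ 4μν·16^{−κ}`,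
total `≤ 4μν/15`. TAIL `κ ≥ dq n + 9 = m`: Parseval on both sides, `|T_{2κ}|/(|PM_n|N_1) ≤ √(μν A_m)` and `16c'²A_m ≤ e^{−2c₀ dq n} ≤ μν`, total
`≤ μν/4`. Hence `μν ≤ (4/15 + 1/4)μν < μν`, contradiction. Constants: `c₀ = min(1, 1/(2736 C τ²))` (`C` = the constant of Thm 1.8 as carried by
`HomogeneousMatchingFamilies.pmatch_closedSum_sq_le`), `n₁ = (2·10⁸)⁴` (so `dq n ≥ 2·10⁸`; lazy but explicit; `e ≤ 3` throughout).
[cite: Rothvoss2017, §2 (PDF p. 6)] [cite: KeevashLifshitz2023, Thm. 1.8] [cite: KupavskiiZakharov2022, §2] [cite: ODonnell2014, §9.5]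
[cite: BrouwerHaemers2012, Prop. 4.3.2 (PDF p. 83)]
Stature: support/instrument — the spread-vs-tight lemma of the r = 1 rung at exp scale, CONDITIONAL on the named fact `GlobalLevelDInequality`
(Keevash–Lifshitz Thm 1.8, not proved in the tree). WHAT THIS IS NOT: not the r = 1 rung (S6 composition with the Kupavskii–Zakharov decomposition,
crossing cells and junk remains), no proof of Thm 1.8, nothing on psd rank, no P-vs-NP content. Supports stmt-PneNP-19878.
-/

set_option linter.dupNamespace false -- `Summit.PneNP.PneNP.…`: summit = sub-problem (D-0017)

noncomputable section

namespace Summit.PneNP.PneNP.Theorems.ChebyshevTracialDesignSpectralNonTightness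

open Finset Literature.Barriers.PneNP Literature.Combinatorics.Optimization
open Literature.Combinatorics.AssociationSchemes Literature.Combinatorics.AssociationSchemes.JohnsonHarmonics
open Literature.Combinatorics.AssociationSchemes.JohnsonSpectrum
open Literature.Combinatorics.AssociationSchemes.HomogeneousMatchingFamilies
open Literature.Combinatorics.SetFamily
open Literature.Combinatorics.Additive.KeevashLifshitz
open Summit.PneNP.PneNP.Theorems.ChebyshevTracialDesignTightFreeSpectral
open Summit.PneNP.PneNP.Theorems.ChebyshevTracialDesignTightColumnSums
open Summit.PneNP.PneNP.Theorems.ChebyshevTracialDesignLevelTail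
open Summit.PneNP.PneNP.Theorems.ChebyshevTracialDesignProfilePolynomial
open Summit.PneNP.PneNP.Theorems.ChebyshevTracialDesignSpectralNonTightnessLayers
open Summit.PneNP.PneNP.Theorems.ChebyshevTracialDesignSpectralNonTightnessEstimates

variable {n : ℕ}

/-! ### §1 The tail terms `κ ≥ dq n + 9`: Parseval on both sides -/

/-- **Tail term bound**: for `m ≤ κ ≤ c'`, `|T_{2κ}(X,Y)|/(|PM_n|·N_1) ≤ √(μ·ν·A_m)` (Parseval form, `A_κ ≤ A_m`, `L_{2κ}/C(n,t) ≤ μ`).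
[cite: BrouwerHaemers2012, Prop. 4.3.2 (PDF p. 83)] [cite: GodsilMeagher2015, §15.2] -/
theorem tail_term_le {c' κ m : ℕ} (hn : Even n) (ht : 2 * (2 * c' + 1) ≤ n) (hκc : κ ≤ c') (hm : m ≤ κ)
    (X : Finset (Finset (Fin n))) (hX : X ⊆ univ.powersetCard (2 * c' + 1)) (Y : Finset (PMatch n))
    (p : ℕ → Finset (Fin n) → ℝ) (hp : ∀ j, IsHarmonic j (p j))
    (hdec : ∀ U ∈ univ.powersetCard (2 * c' + 1),
      (if U ∈ X then (1 : ℝ) else 0) = (∑ j ∈ range (2 * c' + 1 + 1), up^[2 * c' + 1 - j] (p j)) U)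
    (κ₁ : ℕ → ℝ)
    (hA1 : ∀ U ∈ univ.powersetCard (2 * c' + 1), ∀ U' ∈ univ.powersetCard (2 * c' + 1),
      ∑ M : PMatch n, (if (U.filter fun x => M.2.partner x ∉ U).card = 1 then (1 : ℝ) else 0) *
        (if (U'.filter fun x => M.2.partner x ∉ U').card = 1 then (1 : ℝ) else 0) = κ₁ (U ∩ U').card) :
    |∑ M ∈ Y, ∑ U ∈ univ.powersetCard (2 * c' + 1),
        (up^[2 * c' + 1 - 2 * κ] (p (2 * κ))) U * (if (U.filter fun x => M.2.partner x ∉ U).card = 1 then (1 : ℝ) else 0)| /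
        ((Fintype.card (PMatch n) : ℝ) * ((((n / 2).choose (1 + c') * (1 + c').choose c' * 2 ^ 1 : ℕ) : ℝ))) ≤
      Real.sqrt (((X.card : ℝ) / (n.choose (2 * c' + 1) : ℝ)) * ((Y.card : ℝ) / (Fintype.card (PMatch n) : ℝ)) *
        ∏ i ∈ range m, ((2 * i + 1 : ℝ) / ((n : ℝ) - 2 * i))) := by
  have hTb := abs_layerCorr_even_le_parseval hn ht hκc Y p hp κ₁ hA1
  have hPMpos : (0 : ℝ) < Fintype.card (PMatch n) := by exact_mod_cast card_pmatch_pos hn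
  have hCnpos : (0 : ℝ) < n.choose (2 * c' + 1) := by exact_mod_cast Nat.choose_pos (by omega)
  have hN1pos : (0 : ℝ) < ((((n / 2).choose (1 + c') * (1 + c').choose c' * 2 ^ 1 : ℕ) : ℝ)) := by
    have h1 : 0 < (n / 2).choose (1 + c') := Nat.choose_pos (by omega)
    have h2 : 0 < (1 + c').choose c' := Nat.choose_pos (by omega)
    positivity
  have hAmono := atten_mono (n := n) hm (by omega : 4 * κ ≤ n + 3)
  have hLμ : ip (up^[2 * c' + 1 - 2 * κ] (p (2 * κ))) (up^[2 * c' + 1 - 2 * κ] (p (2 * κ))) / (n.choose (2 * c' + 1) : ℝ) ≤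
      (X.card : ℝ) / (n.choose (2 * c' + 1) : ℝ) :=
    div_le_div_of_nonneg_right (ladder_ip_le_card (by omega) X hX p hp hdec) hCnpos.le
  rw [div_le_iff₀ (by positivity)]
  refine hTb.trans ?_
  rw [mul_comm (Real.sqrt _) _]
  refine mul_le_mul_of_nonneg_left (Real.sqrt_le_sqrt ?_) (by positivity)
  have hY0 : (0 : ℝ) ≤ (Y.card : ℝ) / Fintype.card (PMatch n) := by positivity
  have hA0 : 0 ≤ ∏ i ∈ range m, ((2 * i + 1 : ℝ) / ((n : ℝ) - 2 * i)) := atten_nonneg (by omega)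
  calc (Y.card : ℝ) / Fintype.card (PMatch n) *
        ((∏ i ∈ range κ, ((2 * i + 1 : ℝ) / ((n : ℝ) - 2 * i))) *
          (ip (up^[2 * c' + 1 - 2 * κ] (p (2 * κ))) (up^[2 * c' + 1 - 2 * κ] (p (2 * κ))) / (n.choose (2 * c' + 1) : ℝ)))
      ≤ (Y.card : ℝ) / Fintype.card (PMatch n) *
        ((∏ i ∈ range m, ((2 * i + 1 : ℝ) / ((n : ℝ) - 2 * i))) * ((X.card : ℝ) / (n.choose (2 * c' + 1) : ℝ))) := by
        refine mul_le_mul_of_nonneg_left ?_ hY0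
        exact mul_le_mul hAmono hLμ (div_nonneg (ip_self_nonneg _) hCnpos.le) hA0
    _ = (X.card : ℝ) / (n.choose (2 * c' + 1) : ℝ) * ((Y.card : ℝ) / Fintype.card (PMatch n)) *
        ∏ i ∈ range m, ((2 * i + 1 : ℝ) / ((n : ℝ) - 2 * i)) := by ring
/-! ### §2 Spectral non-tightness -/

/-- **SPECTRAL NON-TIGHTNESS (SNT), modulo Keevash–Lifshitz Thm 1.8.** Assume the named fact `GlobalLevelDInequality`. For every `τ ≥ 1`
there are `c₀ > 0` and `n₁` such that: for all even `n ≥ n₁`, all `t = 2c'+1` with `2t ≤ n ≤ 4t`, every family `X` of `t`-subsets of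
`Fin n` with `|X|/C(n,t) ≥ exp(−c₀·dq n)`, and every set `Y` of perfect matchings of `K_n` whose edge sets are `(PM_n, τ)`-homogeneous with
`|Y|/|PM_n| ≥ exp(−c₀·dq n)`, some pair `(U, M) ∈ X × Y` is TIGHT (`U` contains exactly one vertex whose `M`-partner lies outside `U`,
i.e. `|δ(U) ∩ M| = 1`). Planner p1's SNT lemma (N2-SpreadStructure §SNT (1)) at the exp scale `ℓ = c₀·dq n ≍ n^{1/4}`; the dense
spread cells of the `r = 1` rung are therefore empty. [cite: KeevashLifshitz2023, Thm. 1.8] [cite: KupavskiiZakharov2022, §2]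
[cite: Rothvoss2017, §2 (PDF p. 6)] [cite: ODonnell2014, §9.5] -/
theorem snt_of_globalLevelD (hKL : GlobalLevelDInequality) {τ : ℝ} (hτ : 1 ≤ τ) :
    ∃ c₀ : ℝ, 0 < c₀ ∧ ∃ n₁ : ℕ, ∀ (n c' : ℕ), n₁ ≤ n → Even n → 2 * (2 * c' + 1) ≤ n → n ≤ 4 * (2 * c' + 1) →
      ∀ (X : Finset (Finset (Fin n))), X ⊆ univ.powersetCard (2 * c' + 1) →
      ∀ (Y : Finset (PMatch n)), IsRelHomogeneous τ (perfectMatchings (univ : Finset (Fin n))) (Y.image Subtype.val) →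
      Real.exp (-(c₀ * dq n)) ≤ (X.card : ℝ) / (n.choose (2 * c' + 1) : ℝ) →
      Real.exp (-(c₀ * dq n)) ≤ (Y.card : ℝ) / (Fintype.card (PMatch n) : ℝ) →
      ∃ U ∈ X, ∃ M ∈ Y, (U.filter fun x => M.2.partner x ∉ U).card = 1 := by
  obtain ⟨C, hC, hKLb⟩ := abs_layerCorr_even_le_KL hKL
  have hτ0 : 0 < τ := one_pos.trans_le hτ
  have hc₁pos : 0 < 1 / (2736 * C * τ ^ 2) := by positivity
  refine ⟨min 1 (1 / (2736 * C * τ ^ 2)), lt_min one_pos hc₁pos, (2 * 10 ^ 8) ^ 4, ?_⟩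
  intro n c' hn₁ hn ht hbal X hX Y hhom hμ hν
  have hc₀0 : 0 < min 1 (1 / (2736 * C * τ ^ 2)) := lt_min one_pos hc₁pos
  have hc₀1 : min 1 (1 / (2736 * C * τ ^ 2)) ≤ 1 := min_le_left _ _
  have hc₀C : min 1 (1 / (2736 * C * τ ^ 2)) ≤ 1 / (2736 * C * τ ^ 2) := min_le_right _ _
  -- the size parameter `D = dq n ≥ 2·10⁸`, `D⁴ ≤ n`
  have hD : 2 * 10 ^ 8 ≤ dq n := by
    unfold dq
    rw [Nat.le_sqrt, Nat.le_sqrt]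
    calc 2 * 10 ^ 8 * (2 * 10 ^ 8) * (2 * 10 ^ 8 * (2 * 10 ^ 8)) = (2 * 10 ^ 8) ^ 4 := by norm_num
      _ ≤ n := hn₁
  have hD4n : dq n ^ 4 ≤ n := by
    have h1 : dq n * dq n ≤ Nat.sqrt n := Nat.sqrt_le (Nat.sqrt n)
    calc dq n ^ 4 = (dq n * dq n) * (dq n * dq n) := by ring
      _ ≤ Nat.sqrt n * Nat.sqrt n := Nat.mul_le_mul h1 h1
      _ ≤ n := Nat.sqrt_le n
  have hD2 : dq n * dq n ≤ dq n ^ 4 := by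
    calc dq n * dq n = dq n * dq n * 1 := (mul_one _).symm
      _ ≤ dq n * dq n * (dq n * dq n) := Nat.mul_le_mul_left _ (Nat.one_le_iff_ne_zero.2 (by positivity))
      _ = dq n ^ 4 := by ring
  have h64 : 64 ≤ n := by
    have : 64 ≤ dq n * dq n := by nlinarith
    omega
  have h16 : 16 * (dq n + 8) ≤ n := by
    have : 16 * (dq n + 8) ≤ dq n * dq n := by nlinarith
    omega
  by_contra hcon
  push Not at hcon
  -- the harmonic layer decomposition of `1_X` and the Gram class function of the tight incidence
  have hhomog : IsHomog (2 * c' + 1) (fun U : Finset (Fin n) => if U ∈ X then (1 : ℝ) else 0) := by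
    intro S hS
    simp only
    rw [if_neg]
    intro hSX
    exact hS (mem_powersetCard.1 (hX hSX)).2
  obtain ⟨p, hp, hpeq⟩ := exists_ladder_decomposition (by omega : 2 * (2 * c' + 1) ≤ n + 1) hhomog
  have hdec : ∀ U ∈ univ.powersetCard (2 * c' + 1),
      (if U ∈ X then (1 : ℝ) else 0) = (∑ j ∈ range (2 * c' + 1 + 1), up^[2 * c' + 1 - j] (p j)) U :=
    fun U _ => congrFun hpeq U
  obtain ⟨κ₁, hA1⟩ := exists_tightGram_classFunction (n := n) (t := 2 * c' + 1) ⟨c', rfl⟩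
  -- densities
  have hPMpos : (0 : ℝ) < Fintype.card (PMatch n) := by exact_mod_cast card_pmatch_pos hn
  have hCnpos : (0 : ℝ) < (n.choose (2 * c' + 1) : ℝ) := by exact_mod_cast Nat.choose_pos (by omega)
  have hN1pos : (0 : ℝ) < ((((n / 2).choose (1 + c') * (1 + c').choose c' * 2 ^ 1 : ℕ) : ℝ)) := by
    have h1 : 0 < (n / 2).choose (1 + c') := Nat.choose_pos (by omega)
    have h2 : 0 < (1 + c').choose c' := Nat.choose_pos (by omega)
    positivity
  have hμ1 : (X.card : ℝ) / (n.choose (2 * c' + 1) : ℝ) ≤ 1 := by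
    rw [div_le_one hCnpos]
    have := card_le_card hX
    rw [card_powersetCard, card_univ, Fintype.card_fin] at this
    exact_mod_cast this
  have hν1 : (Y.card : ℝ) / (Fintype.card (PMatch n) : ℝ) ≤ 1 := by
    rw [div_le_one hPMpos]
    exact_mod_cast (card_le_univ Y).trans_eq Finset.card_univ
  have hμ0 : 0 < (X.card : ℝ) / (n.choose (2 * c' + 1) : ℝ) := (Real.exp_pos _).trans_le hμ
  have hν0 : 0 < (Y.card : ℝ) / (Fintype.card (PMatch n) : ℝ) := (Real.exp_pos _).trans_le hν
  -- the normalised tightness identity, split into head and tail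
  have hid := density_mul_density_le_sum_abs hn ht X hX Y p hp hdec hcon
  rw [← sum_filter_add_sum_filter_not (Icc 1 c') (fun κ => κ ≤ dq n + 8)] at hid
  -- HEAD
  have hhead : ∀ κ ∈ (Icc 1 c').filter (fun κ => κ ≤ dq n + 8),
      |∑ M ∈ Y, ∑ U ∈ univ.powersetCard (2 * c' + 1),
          (up^[2 * c' + 1 - 2 * κ] (p (2 * κ))) U * (if (U.filter fun x => M.2.partner x ∉ U).card = 1 then (1 : ℝ) else 0)| /
          ((Fintype.card (PMatch n) : ℝ) * ((((n / 2).choose (1 + c') * (1 + c').choose c' * 2 ^ 1 : ℕ) : ℝ))) ≤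
        4 * ((X.card : ℝ) / (n.choose (2 * c' + 1) : ℝ)) * ((Y.card : ℝ) / (Fintype.card (PMatch n) : ℝ)) * (1 / 16) ^ κ := by
    intro κ hκ
    obtain ⟨hκI, hκD⟩ := mem_filter.1 hκ
    obtain ⟨hκ1, hκc⟩ := mem_Icc.1 hκI
    have h4κn : 4 * κ ≤ n := by omega
    have h16κn : 8 * (2 * κ) ≤ n := by omega
    have hL := ladder_ip_le_level (t := 2 * c' + 1) (j := 2 * κ) h64 hbal (by omega) (by omega) h16κn X hX p hp hdec
    have hLq : ip (up^[2 * c' + 1 - 2 * κ] (p (2 * κ))) (up^[2 * c' + 1 - 2 * κ] (p (2 * κ))) / (n.choose (2 * c' + 1) : ℝ) ≤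
        16 * ((X.card : ℝ) / (n.choose (2 * c' + 1) : ℝ)) ^ 2 *
          (48 * (Real.exp 1 * (2 * Real.log (1 / ((X.card : ℝ) / (n.choose (2 * c' + 1) : ℝ))) / ((2 * κ : ℕ) : ℝ) + 3))) ^
            (2 * κ) := by
      rw [div_le_iff₀ hCnpos]
      calc ip (up^[2 * c' + 1 - 2 * κ] (p (2 * κ))) (up^[2 * c' + 1 - 2 * κ] (p (2 * κ)))
          ≤ 16 * (n.choose (2 * c' + 1) : ℝ) * ((X.card : ℝ) / (n.choose (2 * c' + 1) : ℝ)) ^ 2 *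
            (48 * (Real.exp 1 * (2 * Real.log (1 / ((X.card : ℝ) / (n.choose (2 * c' + 1) : ℝ))) / ((2 * κ : ℕ) : ℝ) + 3))) ^
              (2 * κ) := hL
        _ = 16 * ((X.card : ℝ) / (n.choose (2 * c' + 1) : ℝ)) ^ 2 *
            (48 * (Real.exp 1 * (2 * Real.log (1 / ((X.card : ℝ) / (n.choose (2 * c' + 1) : ℝ))) / ((2 * κ : ℕ) : ℝ) + 3))) ^
              (2 * κ) * (n.choose (2 * c' + 1) : ℝ) := by ring
    exact head_term_abstract hC hτ hc₀0 hc₀1 hc₀C hD hD4n hκ1 hκD (mul_pos hPMpos hN1pos) (atten_le_pow h4κn)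
      (div_nonneg (ip_self_nonneg _) hCnpos.le) hLq hμ hμ1 hν hν1
      (fun h8 h5 => hKLb n c' κ hn ht hκ1 hκc Y τ hτ hhom h8 h5 p hp κ₁ hA1)
      (abs_layerCorr_even_le_parseval hn ht hκc Y p hp κ₁ hA1)
  have hheadsum : ∑ κ ∈ (Icc 1 c').filter (fun κ => κ ≤ dq n + 8),
      |∑ M ∈ Y, ∑ U ∈ univ.powersetCard (2 * c' + 1),
          (up^[2 * c' + 1 - 2 * κ] (p (2 * κ))) U * (if (U.filter fun x => M.2.partner x ∉ U).card = 1 then (1 : ℝ) else 0)| /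
          ((Fintype.card (PMatch n) : ℝ) * ((((n / 2).choose (1 + c') * (1 + c').choose c' * 2 ^ 1 : ℕ) : ℝ))) ≤
        4 * ((X.card : ℝ) / (n.choose (2 * c' + 1) : ℝ)) * ((Y.card : ℝ) / (Fintype.card (PMatch n) : ℝ)) * (1 / 15) := by
    refine (sum_le_sum hhead).trans ?_
    rw [← mul_sum]
    refine mul_le_mul_of_nonneg_left ?_ (by positivity)
    have hsub : (Icc 1 c').filter (fun κ => κ ≤ dq n + 8) ⊆ Ico 1 (dq n + 9) := by
      intro κ hκ
      obtain ⟨hκI, hκD⟩ := mem_filter.1 hκ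
      rw [mem_Ico]; have := (mem_Icc.1 hκI).1; omega
    calc ∑ κ ∈ (Icc 1 c').filter (fun κ => κ ≤ dq n + 8), ((1 : ℝ) / 16) ^ κ
        ≤ ∑ κ ∈ Ico 1 (dq n + 9), ((1 : ℝ) / 16) ^ κ :=
          sum_le_sum_of_subset_of_nonneg hsub fun κ _ _ => by positivity
      _ ≤ ((1 : ℝ) / 16) ^ 1 / (1 - 1 / 16) := geom_sum_Ico_le_of_lt_one (by norm_num) (by norm_num)
      _ = 1 / 15 := by norm_num
  -- TAIL
  have htail : ∀ κ ∈ (Icc 1 c').filter (fun κ => ¬κ ≤ dq n + 8),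
      |∑ M ∈ Y, ∑ U ∈ univ.powersetCard (2 * c' + 1),
          (up^[2 * c' + 1 - 2 * κ] (p (2 * κ))) U * (if (U.filter fun x => M.2.partner x ∉ U).card = 1 then (1 : ℝ) else 0)| /
          ((Fintype.card (PMatch n) : ℝ) * ((((n / 2).choose (1 + c') * (1 + c').choose c' * 2 ^ 1 : ℕ) : ℝ))) ≤
        Real.sqrt (((X.card : ℝ) / (n.choose (2 * c' + 1) : ℝ)) * ((Y.card : ℝ) / (Fintype.card (PMatch n) : ℝ)) *
          ∏ i ∈ range (dq n + 9), ((2 * i + 1 : ℝ) / ((n : ℝ) - 2 * i))) := by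
    intro κ hκ
    obtain ⟨hκI, hκD⟩ := mem_filter.1 hκ
    obtain ⟨hκ1, hκc⟩ := mem_Icc.1 hκI
    exact tail_term_le hn ht hκc (by omega) X hX Y p hp hdec κ₁ hA1
  have htailsum : ∑ κ ∈ (Icc 1 c').filter (fun κ => ¬κ ≤ dq n + 8),
      |∑ M ∈ Y, ∑ U ∈ univ.powersetCard (2 * c' + 1),
          (up^[2 * c' + 1 - 2 * κ] (p (2 * κ))) U * (if (U.filter fun x => M.2.partner x ∉ U).card = 1 then (1 : ℝ) else 0)| /
          ((Fintype.card (PMatch n) : ℝ) * ((((n / 2).choose (1 + c') * (1 + c').choose c' * 2 ^ 1 : ℕ) : ℝ))) ≤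
        ((X.card : ℝ) / (n.choose (2 * c' + 1) : ℝ)) * ((Y.card : ℝ) / (Fintype.card (PMatch n) : ℝ)) / 4 := by
    refine (sum_le_sum htail).trans ?_
    rw [sum_const, nsmul_eq_mul]
    have hcard : (((Icc 1 c').filter (fun κ => ¬κ ≤ dq n + 8)).card : ℝ) ≤ c' := by
      have h := card_filter_le (Icc 1 c') (fun κ => ¬κ ≤ dq n + 8)
      rw [Nat.card_Icc] at h
      exact_mod_cast (h.trans (by omega))
    calc (((Icc 1 c').filter (fun κ => ¬κ ≤ dq n + 8)).card : ℝ) *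
          Real.sqrt (((X.card : ℝ) / (n.choose (2 * c' + 1) : ℝ)) * ((Y.card : ℝ) / (Fintype.card (PMatch n) : ℝ)) *
            ∏ i ∈ range (dq n + 9), ((2 * i + 1 : ℝ) / ((n : ℝ) - 2 * i)))
        ≤ (c' : ℝ) * Real.sqrt (((X.card : ℝ) / (n.choose (2 * c' + 1) : ℝ)) * ((Y.card : ℝ) / (Fintype.card (PMatch n) : ℝ)) *
            ∏ i ∈ range (dq n + 9), ((2 * i + 1 : ℝ) / ((n : ℝ) - 2 * i))) :=
          mul_le_mul_of_nonneg_right hcard (Real.sqrt_nonneg _)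
      _ ≤ _ := tail_sum_arith (by omega) ht hc₀1 hμ hν
  -- contradiction
  have hμν : 0 < ((X.card : ℝ) / (n.choose (2 * c' + 1) : ℝ)) * ((Y.card : ℝ) / (Fintype.card (PMatch n) : ℝ)) :=
    mul_pos hμ0 hν0
  linarith

/-- **SNT in the route's currency** (`X : Finset (OddSet n)` of `t`-cuts, `cc U M = |δ(U) ∩ M|`): under `GlobalLevelDInequality`, for every
`τ ≥ 1` there are `c₀ > 0`, `n₁` with: for even `n ≥ n₁`, `t = 2c'+1`, `2t ≤ n ≤ 4t`, `X` a family of `t`-cuts with `|X|/C(n,t) ≥ exp(−c₀ dq n)`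
and `Y` a `(PM_n, τ)`-homogeneous set of perfect matchings with `|Y|/|PM_n| ≥ exp(−c₀ dq n)`, some `(U, M) ∈ X × Y` has `cc U M = 1`.
[cite: KeevashLifshitz2023, Thm. 1.8] [cite: KupavskiiZakharov2022, §2] [cite: Rothvoss2017, §2 (PDF p. 6)] -/
theorem snt_oddSet_of_globalLevelD (hKL : GlobalLevelDInequality) {τ : ℝ} (hτ : 1 ≤ τ) :
    ∃ c₀ : ℝ, 0 < c₀ ∧ ∃ n₁ : ℕ, ∀ (n c' : ℕ), n₁ ≤ n → Even n → 2 * (2 * c' + 1) ≤ n → n ≤ 4 * (2 * c' + 1) →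
      ∀ (X : Finset (OddSet n)), (∀ U ∈ X, U.1.card = 2 * c' + 1) →
      ∀ (Y : Finset (PMatch n)), IsRelHomogeneous τ (perfectMatchings (univ : Finset (Fin n))) (Y.image Subtype.val) →
      Real.exp (-(c₀ * dq n)) ≤ (X.card : ℝ) / (n.choose (2 * c' + 1) : ℝ) →
      Real.exp (-(c₀ * dq n)) ≤ (Y.card : ℝ) / (Fintype.card (PMatch n) : ℝ) →
      ∃ U ∈ X, ∃ M ∈ Y, cc U M = 1 := by
  obtain ⟨c₀, hc₀, n₁, h⟩ := snt_of_globalLevelD hKL hτ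
  refine ⟨c₀, hc₀, n₁, fun n c' hn₁ hn ht hbal X hXt Y hhom hμ hν => ?_⟩
  have hX' : X.image Subtype.val ⊆ univ.powersetCard (2 * c' + 1) := by
    intro U hU
    obtain ⟨U', hU', rfl⟩ := mem_image.1 hU
    exact mem_powersetCard_univ.2 (hXt U' hU')
  have hcard : ((X.image Subtype.val).card : ℝ) = X.card := by
    rw [card_image_of_injective _ Subtype.val_injective]
  obtain ⟨U, hU, M, hM, hUM⟩ := h n c' hn₁ hn ht hbal (X.image Subtype.val) hX' Y hhom (by rw [hcard]; exact hμ) hν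
  obtain ⟨U', hU', rfl⟩ := mem_image.1 hU
  exact ⟨U', hU', M, hM, by rw [cc_eq_card_filter_partner]; exact hUM⟩

end Summit.PneNP.PneNP.Theorems.ChebyshevTracialDesignSpectralNonTightness
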